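import Literature.Geometry.Riemannian.L2ToponogovSmoothFunction
import HarnessLib

/-!
# Colding's `L²`-Toponogov theorem for a smooth function: the derivative-free interpolation form

Continuation of `L2ToponogovSmoothFunction.lean` (step (iii) of the proof of the `L²`-Toponogov
theorem in Colding's volume sphere theorem, `Colding1996_volume_ghClose`; Colding, Invent. Math.
124 (1996), §1; Colding, *Aspects of Ricci curvature* (1997), Thm. 1.1 — "`d_t` is almost equal
to `d̲_t`" for `0 ≤ t ≤ l`, i.e. the comparison holds at EVERY point of the geodesic, not only
at its endpoint). On the unit sphere, `cos d_p` restricted to a unit speed geodesic `γ` is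
`A cos t + B sin t`, whence the three-point identity
  `sin ℓ · cos d_p(γ(t)) = sin(ℓ - t) cos d_p(γ(0)) + sin t · cos d_p(γ(ℓ))`   (`0 ≤ t ≤ ℓ`),
which involves no derivative of the function. For a smooth `u` on a Riemannian manifold whose
spherical Hessian `Hess u + u g` is small in `L¹` we prove that this identity almost holds, at
every intermediate point, along the minimal geodesics between most pairs of points:

* §1 `abs_sin_mul_comp_maximalGeodesic_sub_le` — along a unit speed geodesic `γ_v`,
  `|sin ℓ · u(γ_v t) − sin(ℓ − t) u(x) − sin t · u(γ_v ℓ)| ≤ 2 ∫₀^ℓ |Hess u + u g|_g ∘ γ_v`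
  for `0 ≤ t ≤ ℓ` (eliminate `du(v)` between the estimates of
  `abs_comp_maximalGeodesic_sub_cos_sin_le` at `t` and at `ℓ`);
  `ofReal_abs_sin_mul_sub_le_mul_lintegral` — rescaled: for any `v` and `s ∈ [0, 1]`,
  `|sin|v| u(exp_x(sv)) − sin((1−s)|v|) u(x) − sin(s|v|) u(exp_x v)| ≤ 2|v|∫₀¹|Hess u + ug|(exp_x(tv))dt`.
* §2 `iInf_iSup_ofReal_abs_sin_mul_sub_le` — the infimum over the minimal geodesics `γ` from `x`
  to `y` of the supremum over `s ∈ [0, 1]` of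
  `|sin d · u(γ(s d)) − sin((1−s)d) u(x) − sin(sd) u(y)|`, `d = d(x, y)`, is at most
  `2 ℱ_{|Hess u + ug|}(x, y)` (Cheeger–Colding's functional, `segmentIntegral`).
* §3 `setLIntegral_prod_iInf_iSup_abs_sin_mul_sub_le` — integrated over `A × B` by the segment
  inequality: `≤ 2 (2cosh(D/2))^{d-1} D (Vol A + Vol B) ∫_U |Hess u + u g|_g`;
  `lintegral_prod_segmentIntegral_le_of_contMDiffRiemannianMetric` — on a closed manifold with
  `Ric ≥ (n-1)h`, in the binders of the fact, the common bound
  `∫∫ ℱ_{|Hess u + uh|} ≤ 2π(2cosh(π/2))^{n-1} V √(V(A + (n−1)√(AB)))`, `A = ‖Δu + nu‖₂²`, `B = ‖u‖₂²`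
  (Myers, Cauchy–Schwarz and Colding's `L²` Hessian estimate), and
  **`lintegral_prod_iInf_iSup_abs_sin_mul_sub_le_of_contMDiffRiemannianMetric`** — the
  interpolation form of the `L²`-Toponogov theorem for `u` with right-hand side twice that bound.

Applied to a smoothing `u` of `cos d_p` with `‖Δu + nu‖₂` small, and combined with
`sup |u − cos d_p| ≤ ψ`, this is the form in which the distance comparison `d_t ≈ d̲_t` of
Thm. 1.1 is obtained (no derivative of `u` has to be compared with one of `cos d_p`).
All results are proved; no definitions, no named facts (D-0026).

## References

* T. H. Colding, *Shape of manifolds with positive Ricci curvature*, Invent. Math. 124 (1996)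
  175–191, §1 (Lemma 1.4, Prop. 1.15). [Colding1996Shape]
* T. H. Colding, *Aspects of Ricci curvature*, in: Comparison Geometry, MSRI Publ. 30 (1997)
  83–98, Thm. 1.1 and the sketch of its proof, p. 88. [Colding1997Aspects]
* J. Cheeger, T. H. Colding, Ann. of Math. 144 (1996) 189–237, Thm. 2.11. [CheegerColding1996]
-/

noncomputable section

open Bundle Set Function Filter MeasureTheory Manifold
open scoped Manifold ContDiff Topology ENNReal

namespace Literature.Geometry.Riemannian

open Lorentzian Lorentzian.PseudoRiemannianMetric

/-! ### §1 The three-point estimate along one geodesic -/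

section AlongGeodesics

variable {E : Type*} [NormedAddCommGroup E] [NormedSpace ℝ E] [FiniteDimensional ℝ E]
  [CompleteSpace E] {M : Type*} [TopologicalSpace M] [ChartedSpace E M] [IsManifold 𝓘(ℝ, E) ∞ M]
  [T2Space M]
  (g : PseudoRiemannianMetric 𝓘(ℝ, E) ∞ E (TangentSpace 𝓘(ℝ, E) : M → Type _)) [g.HasLeviCivita]

/-- **The three-point estimate along a unit speed geodesic** (Colding 1997, Thm. 1.1: the
comparison at every `0 ≤ t ≤ l`). For a complete Levi-Civita connection, a smooth `u`, a unit
vector `v ∈ T_x M` and `0 ≤ t ≤ ℓ`, along `γ_v`: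
  `|sin ℓ · u(γ_v t) − (sin(ℓ − t) u(x) + sin t · u(γ_v ℓ))| ≤ 2 ∫₀^ℓ |Hess u + u g|_g (γ_v s) ds`
— with `D(s) = u(γ_v s) − u(x) cos s − du_x(v) sin s`, the left side is
`|sin ℓ D(t) − sin t D(ℓ)|` (`sin(ℓ − t) = sin ℓ cos t − cos ℓ sin t`), and
`|D(s)| ≤ ∫₀ˢ |Hess u + ug| ≤ ∫₀^ℓ |Hess u + ug|` by `abs_comp_maximalGeodesic_sub_cos_sin_le`.
[cite: Colding1996Shape, §1] [cite: Colding1997Aspects, Thm. 1.1, p. 88] -/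
theorem abs_sin_mul_comp_maximalGeodesic_sub_le (hg : g.IsRiemannian)
    (hc : IsGeodesicallyComplete g.leviCivita) {u : M → ℝ} (hu : ContMDiff 𝓘(ℝ, E) 𝓘(ℝ, ℝ) ∞ u)
    (x : M) {v : TangentSpace 𝓘(ℝ, E) x} (hv : g.val x v v = 1) {t ℓ : ℝ} (ht : 0 ≤ t)
    (htℓ : t ≤ ℓ) :
    |Real.sin ℓ * u (maximalGeodesic g.leviCivita x v t) -
        (Real.sin (ℓ - t) * u x + Real.sin t * u (maximalGeodesic g.leviCivita x v ℓ))| ≤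
      2 * ∫ s in (0:ℝ)..ℓ, Real.sqrt (g.normSq (maximalGeodesic g.leviCivita x v s)
        (g.hessian u (maximalGeodesic g.leviCivita x v s) +
          u (maximalGeodesic g.leviCivita x v s) •
            g.toBilinForm (maximalGeodesic g.leviCivita x v s))) := by
  haveI : Fact ((1 : ℕ∞ω) ≤ ((⊤ : ℕ∞) : ℕ∞ω)) := ⟨by exact_mod_cast le_top⟩
  have hk1 : ((1 : ℕ∞) : ℕ∞ω) + 1 ≤ ((⊤ : ℕ∞) : ℕ∞ω) := by
    rw [show ((1 : ℕ∞) : ℕ∞ω) + 1 = 2 by norm_num]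
    exact WithTop.coe_le_coe.2 le_top
  haveI : CovariantDerivative.ContMDiffCovariantDerivative g.leviCivita 1 :=
    ⟨g.isLocallyContMDiff_leviCivita_holds 1 hk1 univ isOpen_univ⟩
  have hℓ : 0 ≤ ℓ := ht.trans htℓ
  set γ := maximalGeodesic g.leviCivita x v with hγ_def
  set F : M → ℝ := fun z ↦ Real.sqrt (g.normSq z (g.hessian u z + u z • g.toBilinForm z))
    with hF_def
  have hF0 : ∀ z, 0 ≤ F z := fun z ↦ Real.sqrt_nonneg _
  have hγc : Continuous γ := (maximalGeodesic_of_isGeodesicallyComplete hc x v).2.1.continuous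
  have hFγ : Continuous fun s ↦ F (γ s) := (continuous_sqrt_normSq_hessian_add_smul g hu).comp hγc
  have hint : ∀ a b : ℝ, IntervalIntegrable (fun s ↦ F (γ s)) volume a b := fun a b ↦
    hFγ.intervalIntegrable a b
  set I : ℝ := ∫ s in (0:ℝ)..ℓ, F (γ s) with hI_def
  set a : ℝ := mvfderiv 𝓘(ℝ, E) u x v with ha_def
  -- the two endpoint estimates
  have hDt : |u (γ t) - (u x * Real.cos t + a * Real.sin t)| ≤ I := by
    refine (abs_comp_maximalGeodesic_sub_cos_sin_le g hg hc hu x hv ht).trans ?_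
    exact intervalIntegral.integral_mono_interval le_rfl ht htℓ
      (Eventually.of_forall fun s ↦ hF0 _) (hint 0 ℓ)
  have hDℓ : |u (γ ℓ) - (u x * Real.cos ℓ + a * Real.sin ℓ)| ≤ I :=
    abs_comp_maximalGeodesic_sub_cos_sin_le g hg hc hu x hv hℓ
  -- elimination of `a`
  have hid : Real.sin ℓ * u (γ t) - (Real.sin (ℓ - t) * u x + Real.sin t * u (γ ℓ)) =
      Real.sin ℓ * (u (γ t) - (u x * Real.cos t + a * Real.sin t)) -
        Real.sin t * (u (γ ℓ) - (u x * Real.cos ℓ + a * Real.sin ℓ)) := by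
    rw [Real.sin_sub]
    ring
  rw [hid]
  calc |Real.sin ℓ * (u (γ t) - (u x * Real.cos t + a * Real.sin t)) -
        Real.sin t * (u (γ ℓ) - (u x * Real.cos ℓ + a * Real.sin ℓ))|
      ≤ |Real.sin ℓ * (u (γ t) - (u x * Real.cos t + a * Real.sin t))| +
          |Real.sin t * (u (γ ℓ) - (u x * Real.cos ℓ + a * Real.sin ℓ))| := abs_sub _ _
    _ = |Real.sin ℓ| * |u (γ t) - (u x * Real.cos t + a * Real.sin t)| +
          |Real.sin t| * |u (γ ℓ) - (u x * Real.cos ℓ + a * Real.sin ℓ)| := by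
        rw [abs_mul, abs_mul]
    _ ≤ 1 * I + 1 * I :=
        add_le_add (mul_le_mul (Real.abs_sin_le_one _) hDt (abs_nonneg _) zero_le_one)
          (mul_le_mul (Real.abs_sin_le_one _) hDℓ (abs_nonneg _) zero_le_one)
    _ = 2 * I := by ring

/-- **The rescaled three-point estimate** for an arbitrary initial vector `v ∈ T_x M`,
`ℓ = |v|_g`, and `s ∈ [0, 1]`:
  `|sin ℓ · u(exp_x(s v)) − (sin((1−s)ℓ) u(x) + sin(sℓ) u(exp_x v))| ≤ 2ℓ ∫₀¹ |Hess u + ug|_g(exp_x(tv)) dt`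
in `ℝ≥0∞` (the right-hand side is twice the window integral of `ℱ_{|Hess u + ug|}` along `γ_v`).
[cite: Colding1996Shape, §1] -/
theorem ofReal_abs_sin_mul_sub_le_mul_lintegral (hg : g.IsRiemannian)
    (hc : IsGeodesicallyComplete g.leviCivita) {u : M → ℝ} (hu : ContMDiff 𝓘(ℝ, E) 𝓘(ℝ, ℝ) ∞ u)
    (x : M) (v : TangentSpace 𝓘(ℝ, E) x) {s : ℝ} (hs0 : 0 ≤ s) (hs1 : s ≤ 1) :
    ENNReal.ofReal |Real.sin (Real.sqrt (g.val x v v)) * u (expMap g.leviCivita x (s • v)) -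
        (Real.sin ((1 - s) * Real.sqrt (g.val x v v)) * u x +
          Real.sin (s * Real.sqrt (g.val x v v)) * u (expMap g.leviCivita x v))| ≤
      2 * (ENNReal.ofReal (Real.sqrt (g.val x v v)) *
        ∫⁻ t in Ioo (0:ℝ) 1, ENNReal.ofReal (Real.sqrt (g.normSq (expMap g.leviCivita x (t • v))
          (g.hessian u (expMap g.leviCivita x (t • v)) +
            u (expMap g.leviCivita x (t • v)) • g.toBilinForm (expMap g.leviCivita x (t • v)))))) := by
  haveI : Fact ((1 : ℕ∞ω) ≤ ((⊤ : ℕ∞) : ℕ∞ω)) := ⟨by exact_mod_cast le_top⟩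
  have hk1 : ((1 : ℕ∞) : ℕ∞ω) + 1 ≤ ((⊤ : ℕ∞) : ℕ∞ω) := by
    rw [show ((1 : ℕ∞) : ℕ∞ω) + 1 = 2 by norm_num]
    exact WithTop.coe_le_coe.2 le_top
  haveI : CovariantDerivative.ContMDiffCovariantDerivative g.leviCivita 1 :=
    ⟨g.isLocallyContMDiff_leviCivita_holds 1 hk1 univ isOpen_univ⟩
  set F : M → ℝ := fun z ↦ Real.sqrt (g.normSq z (g.hessian u z + u z • g.toBilinForm z))
    with hF_def
  have hFc : Continuous F := continuous_sqrt_normSq_hessian_add_smul g hu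
  have hF0 : ∀ z, 0 ≤ F z := fun z ↦ Real.sqrt_nonneg _
  by_cases hv : v = 0
  · -- `v = 0`: `ℓ = 0` and the left side vanishes
    subst hv
    have h0 : g.val x (0 : TangentSpace 𝓘(ℝ, E) x) 0 = 0 := by simp
    rw [h0, Real.sqrt_zero, mul_zero, mul_zero, Real.sin_zero, zero_mul, zero_mul, zero_mul,
      add_zero, sub_self, abs_zero, ENNReal.ofReal_zero]
    exact bot_le
  set ℓ : ℝ := Real.sqrt (g.val x v v) with hℓ_def
  have hvv : 0 < g.val x v v := hg x v hv
  have hℓ : 0 < ℓ := Real.sqrt_pos.2 hvv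
  have hℓ2 : ℓ ^ 2 = g.val x v v := Real.sq_sqrt hvv.le
  set w : TangentSpace 𝓘(ℝ, E) x := ℓ⁻¹ • v with hw_def
  have hw : g.val x w w = 1 := by
    simp only [hw_def, map_smul, FunLike.coe_smul, Pi.smul_apply, smul_eq_mul]
    rw [← hℓ2]
    field_simp
  -- §1 at `t = s ℓ ≤ ℓ`
  have key := abs_sin_mul_comp_maximalGeodesic_sub_le g hg hc hu x hw
    (mul_nonneg hs0 hℓ.le) (mul_le_of_le_one_left hℓ.le hs1)
  have hγw : ∀ r, maximalGeodesic g.leviCivita x w r = expMap g.leviCivita x ((ℓ⁻¹ * r) • v) := by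
    intro r
    rw [hw_def, maximalGeodesic_smul hc x v ℓ⁻¹ r, expMap_smul hc x v]
  have hend : maximalGeodesic g.leviCivita x w ℓ = expMap g.leviCivita x v := by
    rw [hγw ℓ, inv_mul_cancel₀ hℓ.ne', one_smul]
  have hmid : maximalGeodesic g.leviCivita x w (s * ℓ) = expMap g.leviCivita x (s • v) := by
    rw [hγw (s * ℓ), ← mul_assoc, mul_comm ℓ⁻¹ s, mul_assoc, inv_mul_cancel₀ hℓ.ne', mul_one]
  have hsub : ℓ - s * ℓ = (1 - s) * ℓ := by ring
  rw [hend, hmid, hsub] at key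
  -- change of variables in the right-hand side
  have hcv : ∫ r in (0:ℝ)..ℓ, F (maximalGeodesic g.leviCivita x w r) =
      ℓ * ∫ t in (0:ℝ)..1, F (expMap g.leviCivita x (t • v)) := by
    have h1 : (fun r ↦ F (maximalGeodesic g.leviCivita x w r)) =
        fun r ↦ (fun t ↦ F (expMap g.leviCivita x (t • v))) (ℓ⁻¹ * r) :=
      funext fun r ↦ by rw [hγw r]
    rw [h1, intervalIntegral.integral_comp_mul_left
      (fun t ↦ F (expMap g.leviCivita x (t • v))) (inv_ne_zero hℓ.ne'), inv_inv, mul_zero,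
      inv_mul_cancel₀ hℓ.ne', smul_eq_mul]
  have key' : |Real.sin ℓ * u (expMap g.leviCivita x (s • v)) -
      (Real.sin ((1 - s) * ℓ) * u x + Real.sin (s * ℓ) * u (expMap g.leviCivita x v))| ≤
      2 * (ℓ * ∫ t in (0:ℝ)..1, F (expMap g.leviCivita x (t • v))) := by
    have h := key.trans_eq (congrArg (fun r ↦ 2 * r) hcv)
    exact h
  -- pass to `ℝ≥0∞`
  have hGc : Continuous fun t : ℝ ↦ F (expMap g.leviCivita x (t • v)) := by
    have h1 : (fun t : ℝ ↦ F (expMap g.leviCivita x (t • v))) =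
        fun t ↦ F (maximalGeodesic g.leviCivita x v t) := funext fun t ↦ by rw [expMap_smul hc x v t]
    rw [h1]
    exact hFc.comp (maximalGeodesic_of_isGeodesicallyComplete hc x v).2.1.continuous
  have hGi : IntegrableOn (fun t : ℝ ↦ F (expMap g.leviCivita x (t • v))) (Ioc 0 1) volume :=
    (hGc.integrableOn_Icc (a := 0) (b := 1)).mono_set Ioc_subset_Icc_self
  have hG0 : 0 ≤ ∫ t in (0:ℝ)..1, F (expMap g.leviCivita x (t • v)) :=
    intervalIntegral.integral_nonneg zero_le_one fun t _ ↦ hF0 _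
  have hint : ENNReal.ofReal (∫ t in (0:ℝ)..1, F (expMap g.leviCivita x (t • v))) =
      ∫⁻ t in Ioo (0:ℝ) 1, ENNReal.ofReal (F (expMap g.leviCivita x (t • v))) := by
    rw [intervalIntegral.integral_of_le zero_le_one,
      ofReal_integral_eq_lintegral_ofReal hGi (Eventually.of_forall fun t ↦ hF0 _),
      setLIntegral_congr Ioo_ae_eq_Ioc]
  calc ENNReal.ofReal |Real.sin ℓ * u (expMap g.leviCivita x (s • v)) -
          (Real.sin ((1 - s) * ℓ) * u x + Real.sin (s * ℓ) * u (expMap g.leviCivita x v))|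
      ≤ ENNReal.ofReal (2 * (ℓ * ∫ t in (0:ℝ)..1, F (expMap g.leviCivita x (t • v)))) :=
        ENNReal.ofReal_le_ofReal key'
    _ = 2 * (ENNReal.ofReal ℓ *
          ∫⁻ t in Ioo (0:ℝ) 1, ENNReal.ofReal (F (expMap g.leviCivita x (t • v)))) := by
        rw [ENNReal.ofReal_mul zero_le_two, ENNReal.ofReal_ofNat, ENNReal.ofReal_mul hℓ.le, hint]

/-! ### §2 Along the minimal geodesics from `x` to `y` -/

/-- **The interpolation defect is dominated by Cheeger–Colding's functional.** For a complete
Levi-Civita connection, a smooth `u` and `x, y ∈ M` with `d = d(x, y)`, the infimum over the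
minimal geodesics `γ_v : [0, 1] → M`, `exp_x v = y`, of
  `sup_{s ∈ [0,1]} |sin d · u(γ_v(s)) − (sin((1−s)d) u(x) + sin(sd) u(y))|`
is at most `2 ℱ_{|Hess u + u g|_g}(x, y)` (`segmentIntegral`, window `(0, 1)`; for minimal `v`,
`|v|_g = d(x, y)`, `isMinimizingUpTo_one_iff`). [cite: Colding1996Shape, §1]
[cite: CheegerColding1996, §2, (2.11)] -/
theorem iInf_iSup_ofReal_abs_sin_mul_sub_le (hg : g.IsRiemannian)
    (hc : IsGeodesicallyComplete g.leviCivita) {u : M → ℝ} (hu : ContMDiff 𝓘(ℝ, E) 𝓘(ℝ, ℝ) ∞ u)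
    (x y : M) :
    (⨅ v : {v : TangentSpace 𝓘(ℝ, E) x //
        IsMinimizingUpTo g hg x v 1 ∧ expMap g.leviCivita x v = y},
      ⨆ s : Icc (0:ℝ) 1,
        ENNReal.ofReal |Real.sin (g.edist hg x y).toReal *
            u (expMap g.leviCivita x ((s : ℝ) • v.1)) -
          (Real.sin ((1 - s) * (g.edist hg x y).toReal) * u x +
            Real.sin (s * (g.edist hg x y).toReal) * u y)|) ≤
      2 * segmentIntegral g hg
        (fun z ↦ ENNReal.ofReal (Real.sqrt (g.normSq z (g.hessian u z + u z • g.toBilinForm z))))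
        0 1 x y := by
  haveI : Fact ((1 : ℕ∞ω) ≤ ((⊤ : ℕ∞) : ℕ∞ω)) := ⟨by exact_mod_cast le_top⟩
  have hk1 : ((1 : ℕ∞) : ℕ∞ω) + 1 ≤ ((⊤ : ℕ∞) : ℕ∞ω) := by
    rw [show ((1 : ℕ∞) : ℕ∞ω) + 1 = 2 by norm_num]
    exact WithTop.coe_le_coe.2 le_top
  haveI : CovariantDerivative.ContMDiffCovariantDerivative g.leviCivita 1 :=
    ⟨g.isLocallyContMDiff_leviCivita_holds 1 hk1 univ isOpen_univ⟩
  rw [segmentIntegral, ENNReal.mul_iInf_of_ne two_ne_zero ENNReal.ofNat_ne_top]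
  refine le_iInf fun w ↦ ?_
  obtain ⟨v, hv, hvy⟩ := w
  refine (iInf_le _ ⟨v, hv, hvy⟩).trans (iSup_le fun s ↦ ?_)
  subst hvy
  -- for a minimal `v`, `|v|_g = d(x, exp_x v)`
  have hℓ : (g.edist hg x (expMap g.leviCivita x v)).toReal = Real.sqrt (g.val x v v) := by
    have h := (isMinimizingUpTo_one_iff hg hc x v).1 hv
    rw [← h, ENNReal.toReal_ofReal (Real.sqrt_nonneg _)]
  simp only [hℓ]
  exact ofReal_abs_sin_mul_sub_le_mul_lintegral g hg hc hu x v s.2.1 s.2.2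

end AlongGeodesics

/-! ### §3 Integration over pairs -/

section Pairs

variable {d : ℕ} {M : Type*} [TopologicalSpace M] [ChartedSpace (EuclideanSpace ℝ (Fin d)) M]
  [IsManifold 𝓘(ℝ, EuclideanSpace ℝ (Fin d)) ∞ M] [T2Space M]
  (g : PseudoRiemannianMetric 𝓘(ℝ, EuclideanSpace ℝ (Fin d)) ∞ (EuclideanSpace ℝ (Fin d))
    (TangentSpace 𝓘(ℝ, EuclideanSpace ℝ (Fin d)) : M → Type _)) [g.HasLeviCivita]

/-- **Colding's `L²`-Toponogov theorem for a smooth function, interpolation form on two sets**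
(Colding 1996, §1, via Cheeger–Colding's segment inequality). On a connected Riemannian
`d`-manifold (`d ≥ 1`) with complete Levi-Civita connection and `Ric ≥ -(d-1) g`, for smooth `u`,
measurable `A, B, U` with `d ≤ D` on `A × B` and every minimal geodesic from `A` to `B` inside
`U`:
  `∫_{A×B} inf_γ sup_{s∈[0,1]} |sin d·u(γ(s d)) − sin((1−s)d) u(x) − sin(sd) u(y)| d(Vol⊗Vol)`
  `  ≤ 2 (2cosh(D/2))^{d-1} D (Vol A + Vol B) ∫_U |Hess u + u g|_g dVol`.
[cite: Colding1996Shape, §1 (Lemma 1.4, Prop. 1.15)] [cite: CheegerColding1996, §2, Thm. 2.11] -/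
theorem setLIntegral_prod_iInf_iSup_abs_sin_mul_sub_le (hd : 0 < d) [ConnectedSpace M]
    [T3Space M] [SecondCountableTopology M] [MeasurableSpace M] [BorelSpace M]
    (hg : g.IsRiemannian) (hc : IsGeodesicallyComplete g.leviCivita)
    (hRic : ∀ (x : M) (w : TangentSpace 𝓘(ℝ, (EuclideanSpace ℝ (Fin d))) x),
      -((d : ℝ) - 1) * g.val x w w ≤ g.leviCivita.ricci x w w)
    {A B U : Set M} (hA : MeasurableSet A) (hB : MeasurableSet B) (hU : MeasurableSet U)
    {D : ℝ} (hD : 0 ≤ D) (hABD : ∀ x ∈ A, ∀ y ∈ B, g.edist hg x y ≤ ENNReal.ofReal D)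
    (hABU : ∀ x ∈ A, ∀ y ∈ B, ∀ v : TangentSpace 𝓘(ℝ, (EuclideanSpace ℝ (Fin d))) x,
      IsMinimizingUpTo g hg x v 1 → expMap g.leviCivita x v = y →
        ∀ t ∈ Icc (0 : ℝ) 1, expMap g.leviCivita x (t • v) ∈ U)
    {u : M → ℝ} (hu : ContMDiff 𝓘(ℝ, EuclideanSpace ℝ (Fin d)) 𝓘(ℝ, ℝ) ∞ u) :
    ∫⁻ z in A ×ˢ B, (⨅ v : {v : TangentSpace 𝓘(ℝ, EuclideanSpace ℝ (Fin d)) z.1 //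
          IsMinimizingUpTo g hg z.1 v 1 ∧ expMap g.leviCivita z.1 v = z.2},
        ⨆ s : Icc (0:ℝ) 1,
          ENNReal.ofReal |Real.sin (g.edist hg z.1 z.2).toReal *
              u (expMap g.leviCivita z.1 ((s : ℝ) • v.1)) -
            (Real.sin ((1 - s) * (g.edist hg z.1 z.2).toReal) * u z.1 +
              Real.sin (s * (g.edist hg z.1 z.2).toReal) * u z.2)|)
        ∂((riemannianMeasure (I := 𝓘(ℝ, (EuclideanSpace ℝ (Fin d))))
            (g.toContMDiffRiemannianMetric hg)).prod
          (riemannianMeasure (I := 𝓘(ℝ, (EuclideanSpace ℝ (Fin d))))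
            (g.toContMDiffRiemannianMetric hg))) ≤
      2 * (ENNReal.ofReal ((2 * Real.cosh (D / 2)) ^ (d - 1)) * ENNReal.ofReal D *
        ((riemannianMeasure (I := 𝓘(ℝ, (EuclideanSpace ℝ (Fin d))))
            (g.toContMDiffRiemannianMetric hg)) A +
          (riemannianMeasure (I := 𝓘(ℝ, (EuclideanSpace ℝ (Fin d))))
            (g.toContMDiffRiemannianMetric hg)) B) *
        ∫⁻ y in U, ENNReal.ofReal (Real.sqrt (g.normSq y (g.hessian u y + u y • g.toBilinForm y)))
          ∂(riemannianMeasure (I := 𝓘(ℝ, (EuclideanSpace ℝ (Fin d))))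
            (g.toContMDiffRiemannianMetric hg))) := by
  have hk1 : ((1 : ℕ∞) : ℕ∞ω) + 1 ≤ ((⊤ : ℕ∞) : ℕ∞ω) := by
    rw [show ((1 : ℕ∞) : ℕ∞ω) + 1 = 2 by norm_num]
    exact WithTop.coe_le_coe.2 le_top
  haveI : CovariantDerivative.ContMDiffCovariantDerivative g.leviCivita 1 :=
    ⟨g.isLocallyContMDiff_leviCivita_holds 1 hk1 univ isOpen_univ⟩
  haveI : CovariantDerivative.ContMDiffCovariantDerivative g.leviCivita ∞ :=
    ⟨g.isLocallyContMDiff_leviCivita_holds ⊤ (le_of_eq rfl) univ isOpen_univ⟩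
  set f : M → ℝ≥0∞ := fun z ↦
    ENNReal.ofReal (Real.sqrt (g.normSq z (g.hessian u z + u z • g.toBilinForm z))) with hf_def
  have hf : LowerSemicontinuous f :=
    (ENNReal.continuous_ofReal.comp (continuous_sqrt_normSq_hessian_add_smul g hu)).lowerSemicontinuous
  have hseg := setLIntegral_prod_segmentIntegral_le g hd hg hc hRic hA hB hU hD hABD hABU hf
  have hmeas : Measurable fun z : M × M ↦ segmentIntegral g hg f 0 1 z.1 z.2 :=
    measurable_segmentIntegral g hg hc hf 0 1
  calc _ ≤ ∫⁻ z in A ×ˢ B, 2 * segmentIntegral g hg f 0 1 z.1 z.2 ∂_ :=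
        lintegral_mono fun z ↦ iInf_iSup_ofReal_abs_sin_mul_sub_le g hg hc hu z.1 z.2
    _ = 2 * ∫⁻ z in A ×ˢ B, segmentIntegral g hg f 0 1 z.1 z.2 ∂_ := lintegral_const_mul 2 hmeas
    _ ≤ _ := mul_le_mul_right hseg 2

end Pairs

/-! ### §4 The statements for `Colding1996_volume_ghClose` -/

section FactVocabulary

open Literature.Geometry.Lorentzian (riemannianMeasure)

/-- **The common right-hand side, in the binders of `Colding1996_volume_ghClose`**: on a closed
connected Riemannian `n`-manifold `(M, h)`, `n ≥ 2`, with `Ric ≥ (n-1) h`, for every smooth `u`,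
  `∫_{M×M} ℱ_{|Hess u + uh|_h} d(μ_h ⊗ μ_h) ≤ (2cosh(π/2))^{n-1} π · 2V · √(V (A + (n−1)√(AB)))`,
`V = μ_h(M)`, `A = ∫(Δu + nu)²`, `B = ∫u²` — the segment inequality over all pairs (`D = π` by
Myers), Cauchy–Schwarz `∫|Hess u + uh| ≤ √(V∫|Hess u + uh|²)` and Colding's `L²` Hessian estimate
(`colding_integral_normSq_hessian_add_smul_le_sqrt`). [cite: Colding1996Shape, §1]
[cite: Colding1997Aspects, Thm. 1.1, p. 88] [cite: CheegerColding1996, §2, Thm. 2.11] -/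
theorem lintegral_prod_segmentIntegral_le_of_contMDiffRiemannianMetric (n : ℕ) (hn : 2 ≤ n)
    (M : Type) [TopologicalSpace M] [T2Space M] [SecondCountableTopology M]
    [ChartedSpace (EuclideanSpace ℝ (Fin n)) M] [IsManifold (𝓡 n) ∞ M] [CompactSpace M]
    [ConnectedSpace M] [MeasurableSpace M] [BorelSpace M]
    (h : Bundle.ContMDiffRiemannianMetric (𝓡 n) ∞ (EuclideanSpace ℝ (Fin n))
      (TangentSpace (𝓡 n) : M → Type _))
    [(PseudoRiemannianMetric.ofRiemannian h).HasLeviCivita]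
    (hRic : ∀ (x : M) (v : TangentSpace (𝓡 n) x),
      ((n : ℝ) - 1) * h.inner x v v ≤ (PseudoRiemannianMetric.ofRiemannian h).ricci x v v)
    {u : M → ℝ} (hu : ContMDiff (𝓡 n) 𝓘(ℝ, ℝ) ∞ u) :
    ∫⁻ z, segmentIntegral (PseudoRiemannianMetric.ofRiemannian h)
        (PseudoRiemannianMetric.isRiemannian_ofRiemannian h)
        (fun w ↦ ENNReal.ofReal (Real.sqrt ((PseudoRiemannianMetric.ofRiemannian h).normSq w
          ((PseudoRiemannianMetric.ofRiemannian h).hessian u w +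
            u w • (PseudoRiemannianMetric.ofRiemannian h).toBilinForm w)))) 0 1 z.1 z.2
        ∂((riemannianMeasure h).prod (riemannianMeasure h)) ≤
      ENNReal.ofReal ((2 * Real.cosh (Real.pi / 2)) ^ (n - 1) * Real.pi *
        (2 * (riemannianMeasure h univ).toReal) *
        Real.sqrt ((riemannianMeasure h univ).toReal *
          (∫ x, ((PseudoRiemannianMetric.ofRiemannian h).dalembertian u x + n * u x) ^ 2
              ∂riemannianMeasure h +
            ((n : ℝ) - 1) * Real.sqrt
              ((∫ x, ((PseudoRiemannianMetric.ofRiemannian h).dalembertian u x + n * u x) ^ 2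
                  ∂riemannianMeasure h) *
                ∫ x, u x ^ 2 ∂riemannianMeasure h)))) := by
  set g := PseudoRiemannianMetric.ofRiemannian h with hg_def
  have hg : g.IsRiemannian := PseudoRiemannianMetric.isRiemannian_ofRiemannian h
  haveI : LocallyCompactSpace M :=
    Manifold.locallyCompact_of_finiteDimensional 𝓘(ℝ, (EuclideanSpace ℝ (Fin n)))
  haveI : T3Space M := inferInstance
  haveI : IsFiniteMeasure (riemannianMeasure h) :=
    ⟨by
      have := riemannianVolume_lt_top_of_isCompact_holds h le_rfl isCompact_univ
      exact this⟩
  have hk1 : ((1 : ℕ∞) : ℕ∞ω) + 1 ≤ ((⊤ : ℕ∞) : ℕ∞ω) := by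
    rw [show ((1 : ℕ∞) : ℕ∞ω) + 1 = 2 by norm_num]
    exact WithTop.coe_le_coe.2 le_top
  haveI : CovariantDerivative.ContMDiffCovariantDerivative g.leviCivita 1 :=
    ⟨g.isLocallyContMDiff_leviCivita_holds 1 hk1 univ isOpen_univ⟩
  haveI : CovariantDerivative.ContMDiffCovariantDerivative g.leviCivita ∞ :=
    ⟨g.isLocallyContMDiff_leviCivita_holds ⊤ (le_of_eq rfl) univ isOpen_univ⟩
  have hn0 : 0 < n := lt_of_lt_of_le (by norm_num) hn
  have hn1 : 1 ≤ n := le_trans (by norm_num) hn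
  have hc : IsGeodesicallyComplete g.leviCivita := hopfRinow_compact_geodesicallyComplete le_rfl hg
  have hfinE : Module.finrank ℝ (EuclideanSpace ℝ (Fin n)) = n := finrank_euclideanSpace_fin
  -- the majorant
  set F : M → ℝ := fun z ↦ Real.sqrt (g.normSq z (g.hessian u z + u z • g.toBilinForm z))
    with hF_def
  have hFc : Continuous F := continuous_sqrt_normSq_hessian_add_smul g hu
  have hF0 : ∀ z, 0 ≤ F z := fun z ↦ Real.sqrt_nonneg _
  have hf : LowerSemicontinuous fun z : M ↦ ENNReal.ofReal (F z) :=
    (ENNReal.continuous_ofReal.comp hFc).lowerSemicontinuous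
  -- `Ric ≥ (n-1) h ≥ -(n-1) h`
  have hRic' : ∀ (x : M) (w : TangentSpace 𝓘(ℝ, (EuclideanSpace ℝ (Fin n))) x),
      -((n : ℝ) - 1) * g.val x w w ≤ g.leviCivita.ricci x w w := by
    intro x w
    refine le_trans ?_ (hRic x w)
    have hw : 0 ≤ g.val x w w := by
      by_cases h0 : w = 0
      · simp [h0]
      · exact (hg x w h0).le
    have hd1 : (0 : ℝ) ≤ (n : ℝ) - 1 := by
      have : (2 : ℝ) ≤ n := by exact_mod_cast hn
      linarith
    show -((n : ℝ) - 1) * g.val x w w ≤ ((n : ℝ) - 1) * h.inner x w w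
    have : g.val x w w = h.inner x w w := rfl
    rw [← this]
    nlinarith
  -- Myers: `d(x, y) ≤ π`
  have hdiam : ∀ x ∈ (univ : Set M), ∀ y ∈ (univ : Set M),
      g.edist hg x y ≤ ENNReal.ofReal Real.pi := by
    intro x _ y _
    have h' := edist_le_pi_div_sqrt_of_ricci_ge_of_compactSpace g hg (by rw [hfinE]; exact hn)
      one_pos (fun x w ↦ by rw [hfinE, mul_one]; exact hRic x w) x y
    rwa [Real.sqrt_one, div_one] at h'
  have hU : ∀ x ∈ (univ : Set M), ∀ y ∈ (univ : Set M),
      ∀ v : TangentSpace 𝓘(ℝ, (EuclideanSpace ℝ (Fin n))) x,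
        IsMinimizingUpTo g hg x v 1 → expMap g.leviCivita x v = y →
          ∀ t ∈ Icc (0 : ℝ) 1, expMap g.leviCivita x (t • v) ∈ (univ : Set M) :=
    fun _ _ _ _ _ _ _ _ _ ↦ mem_univ _
  have hseg := setLIntegral_prod_segmentIntegral_le g hn0 hg hc hRic' MeasurableSet.univ
    MeasurableSet.univ MeasurableSet.univ Real.pi_pos.le hdiam hU hf
  rw [univ_prod_univ, Measure.restrict_univ, Measure.restrict_univ, ← two_mul] at hseg
  refine hseg.trans ?_
  -- the real-valued bound of `∫ F`
  have hFi : Integrable F (riemannianMeasure h) := integrable_of_continuous h hFc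
  have hF2 : ∀ z, F z ^ 2 = g.normSq z (g.hessian u z + u z • g.toBilinForm z) := fun z ↦
    Real.sq_sqrt (g.normSq_nonneg z hg _)
  have hF2i : Integrable (fun z ↦ F z ^ 2) (riemannianMeasure h) :=
    integrable_of_continuous h (hFc.pow 2)
  have hHess := colding_integral_normSq_hessian_add_smul_le_sqrt h hn1 hRic hu
  set V : ℝ := (riemannianMeasure h univ).toReal with hV
  set A : ℝ := ∫ x, (g.dalembertian u x + n * u x) ^ 2 ∂riemannianMeasure h with hA
  set B : ℝ := ∫ x, u x ^ 2 ∂riemannianMeasure h with hB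
  have hint2 : ∫ z, F z ^ 2 ∂riemannianMeasure h ≤ A + ((n : ℝ) - 1) * Real.sqrt (A * B) := by
    have h1 : ∫ z, F z ^ 2 ∂riemannianMeasure h =
        ∫ z, g.normSq z (g.hessian u z + u z • g.toBilinForm z) ∂riemannianMeasure h :=
      integral_congr_ae (Eventually.of_forall hF2)
    rw [h1]
    exact hHess
  have hV0 : 0 ≤ V := ENNReal.toReal_nonneg
  have hint1 : ∫ z, F z ∂riemannianMeasure h ≤
      Real.sqrt (V * (A + ((n : ℝ) - 1) * Real.sqrt (A * B))) :=
    (integral_le_sqrt_measure_mul_integral_sq hFi hF2i).trans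
      (Real.sqrt_le_sqrt (mul_le_mul_of_nonneg_left hint2 hV0))
  have hlin : ∫⁻ y, ENNReal.ofReal (F y) ∂riemannianMeasure h =
      ENNReal.ofReal (∫ y, F y ∂riemannianMeasure h) :=
    (ofReal_integral_eq_lintegral_ofReal hFi (Eventually.of_forall hF0)).symm
  have hVeq : riemannianMeasure h univ = ENNReal.ofReal V := by
    rw [hV, ENNReal.ofReal_toReal (measure_ne_top _ _)]
  have hC1 : 0 ≤ (2 * Real.cosh (Real.pi / 2)) ^ (n - 1) :=
    pow_nonneg (mul_nonneg zero_le_two (Real.cosh_pos _).le) _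
  have hC2 : 0 ≤ (2 * Real.cosh (Real.pi / 2)) ^ (n - 1) * Real.pi := mul_nonneg hC1 Real.pi_pos.le
  have hC0 : 0 ≤ (2 * Real.cosh (Real.pi / 2)) ^ (n - 1) * Real.pi * (2 * V) :=
    mul_nonneg hC2 (mul_nonneg zero_le_two hV0)
  have h2V : (2 : ℝ≥0∞) * ENNReal.ofReal V = ENNReal.ofReal (2 * V) := by
    rw [ENNReal.ofReal_mul zero_le_two, ENNReal.ofReal_ofNat]
  calc ENNReal.ofReal ((2 * Real.cosh (Real.pi / 2)) ^ (n - 1)) * ENNReal.ofReal Real.pi *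
        (2 * riemannianMeasure (I := 𝓘(ℝ, (EuclideanSpace ℝ (Fin n))))
          (g.toContMDiffRiemannianMetric hg) univ) *
        ∫⁻ y, ENNReal.ofReal (F y) ∂riemannianMeasure (I := 𝓘(ℝ, (EuclideanSpace ℝ (Fin n))))
          (g.toContMDiffRiemannianMetric hg)
      = ENNReal.ofReal ((2 * Real.cosh (Real.pi / 2)) ^ (n - 1) * Real.pi * (2 * V)) *
          ENNReal.ofReal (∫ y, F y ∂riemannianMeasure h) := by
        change ENNReal.ofReal ((2 * Real.cosh (Real.pi / 2)) ^ (n - 1)) * ENNReal.ofReal Real.pi *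
            (2 * riemannianMeasure h univ) *
            ∫⁻ y, ENNReal.ofReal (F y) ∂riemannianMeasure h = _
        rw [hlin, hVeq, h2V, ← ENNReal.ofReal_mul hC1, ← ENNReal.ofReal_mul hC2]
    _ ≤ ENNReal.ofReal ((2 * Real.cosh (Real.pi / 2)) ^ (n - 1) * Real.pi * (2 * V)) *
          ENNReal.ofReal (Real.sqrt (V * (A + ((n : ℝ) - 1) * Real.sqrt (A * B)))) :=
        mul_le_mul' le_rfl (ENNReal.ofReal_le_ofReal hint1)
    _ = ENNReal.ofReal ((2 * Real.cosh (Real.pi / 2)) ^ (n - 1) * Real.pi * (2 * V) *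
          Real.sqrt (V * (A + ((n : ℝ) - 1) * Real.sqrt (A * B)))) := by
        rw [← ENNReal.ofReal_mul hC0]

/-- **Colding's `L²`-Toponogov theorem for a smooth function, interpolation form, in the binders
of `Colding1996_volume_ghClose`** (Colding 1996, §1; Colding 1997, Thm. 1.1). On a closed
connected Riemannian `n`-manifold `(M, h)`, `n ≥ 2`, with `Ric ≥ (n-1) h`, for every smooth `u`,
with `V = μ_h(M)`, `A = ∫(Δu + nu)²`, `B = ∫u²`:
  `∫_{M×M} inf_γ sup_{s∈[0,1]} |sin d · u(γ(s d)) − (sin((1−s)d) u(x) + sin(sd) u(y))| d(μ_h⊗μ_h)`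
  `  ≤ 2 · (2cosh(π/2))^{n-1} π · 2V · √(V (A + (n−1)√(AB)))`,
`d = d(x, y)`, the infimum over the minimal geodesics `γ` from `x` to `y` (unit speed) — for `u`
with `‖Δu + nu‖₂` small the three-point identity of `cos d_p` on `Sⁿ` holds for `u` in `L¹` over
the pairs `(x, y)`, uniformly in the intermediate point.
[cite: Colding1996Shape, §1 (Lemma 1.4, Prop. 1.15)] [cite: Colding1997Aspects, Thm. 1.1, p. 88] -/
theorem lintegral_prod_iInf_iSup_abs_sin_mul_sub_le_of_contMDiffRiemannianMetric (n : ℕ)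
    (hn : 2 ≤ n)
    (M : Type) [TopologicalSpace M] [T2Space M] [SecondCountableTopology M]
    [ChartedSpace (EuclideanSpace ℝ (Fin n)) M] [IsManifold (𝓡 n) ∞ M] [CompactSpace M]
    [ConnectedSpace M] [MeasurableSpace M] [BorelSpace M]
    (h : Bundle.ContMDiffRiemannianMetric (𝓡 n) ∞ (EuclideanSpace ℝ (Fin n))
      (TangentSpace (𝓡 n) : M → Type _))
    [(PseudoRiemannianMetric.ofRiemannian h).HasLeviCivita]
    (hRic : ∀ (x : M) (v : TangentSpace (𝓡 n) x),
      ((n : ℝ) - 1) * h.inner x v v ≤ (PseudoRiemannianMetric.ofRiemannian h).ricci x v v)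
    {u : M → ℝ} (hu : ContMDiff (𝓡 n) 𝓘(ℝ, ℝ) ∞ u) :
    ∫⁻ z, (⨅ v : {v : TangentSpace (𝓡 n) z.1 //
          IsMinimizingUpTo (PseudoRiemannianMetric.ofRiemannian h)
              (PseudoRiemannianMetric.isRiemannian_ofRiemannian h) z.1 v 1 ∧
            expMap (PseudoRiemannianMetric.ofRiemannian h).leviCivita z.1 v = z.2},
        ⨆ s : Icc (0:ℝ) 1,
          ENNReal.ofReal |Real.sin ((PseudoRiemannianMetric.ofRiemannian h).edist
                (PseudoRiemannianMetric.isRiemannian_ofRiemannian h) z.1 z.2).toReal *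
              u (expMap (PseudoRiemannianMetric.ofRiemannian h).leviCivita z.1 ((s : ℝ) • v.1)) -
            (Real.sin ((1 - s) * ((PseudoRiemannianMetric.ofRiemannian h).edist
                (PseudoRiemannianMetric.isRiemannian_ofRiemannian h) z.1 z.2).toReal) * u z.1 +
              Real.sin (s * ((PseudoRiemannianMetric.ofRiemannian h).edist
                (PseudoRiemannianMetric.isRiemannian_ofRiemannian h) z.1 z.2).toReal) * u z.2)|)
        ∂((riemannianMeasure h).prod (riemannianMeasure h)) ≤
      2 * ENNReal.ofReal ((2 * Real.cosh (Real.pi / 2)) ^ (n - 1) * Real.pi *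
        (2 * (riemannianMeasure h univ).toReal) *
        Real.sqrt ((riemannianMeasure h univ).toReal *
          (∫ x, ((PseudoRiemannianMetric.ofRiemannian h).dalembertian u x + n * u x) ^ 2
              ∂riemannianMeasure h +
            ((n : ℝ) - 1) * Real.sqrt
              ((∫ x, ((PseudoRiemannianMetric.ofRiemannian h).dalembertian u x + n * u x) ^ 2
                  ∂riemannianMeasure h) *
                ∫ x, u x ^ 2 ∂riemannianMeasure h)))) := by
  set g := PseudoRiemannianMetric.ofRiemannian h with hg_def
  have hg : g.IsRiemannian := PseudoRiemannianMetric.isRiemannian_ofRiemannian h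
  haveI : LocallyCompactSpace M :=
    Manifold.locallyCompact_of_finiteDimensional 𝓘(ℝ, (EuclideanSpace ℝ (Fin n)))
  haveI : T3Space M := inferInstance
  have hk1 : ((1 : ℕ∞) : ℕ∞ω) + 1 ≤ ((⊤ : ℕ∞) : ℕ∞ω) := by
    rw [show ((1 : ℕ∞) : ℕ∞ω) + 1 = 2 by norm_num]
    exact WithTop.coe_le_coe.2 le_top
  haveI : CovariantDerivative.ContMDiffCovariantDerivative g.leviCivita 1 :=
    ⟨g.isLocallyContMDiff_leviCivita_holds 1 hk1 univ isOpen_univ⟩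
  haveI : CovariantDerivative.ContMDiffCovariantDerivative g.leviCivita ∞ :=
    ⟨g.isLocallyContMDiff_leviCivita_holds ⊤ (le_of_eq rfl) univ isOpen_univ⟩
  have hc : IsGeodesicallyComplete g.leviCivita := hopfRinow_compact_geodesicallyComplete le_rfl hg
  have hf : LowerSemicontinuous fun z : M ↦
      ENNReal.ofReal (Real.sqrt (g.normSq z (g.hessian u z + u z • g.toBilinForm z))) :=
    (ENNReal.continuous_ofReal.comp (continuous_sqrt_normSq_hessian_add_smul g hu)).lowerSemicontinuous
  have hmeas : Measurable fun z : M × M ↦ segmentIntegral g hg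
      (fun w ↦ ENNReal.ofReal (Real.sqrt (g.normSq w (g.hessian u w + u w • g.toBilinForm w))))
      0 1 z.1 z.2 :=
    measurable_segmentIntegral g hg hc hf 0 1
  have hcommon := lintegral_prod_segmentIntegral_le_of_contMDiffRiemannianMetric n hn M h hRic hu
  calc _ ≤ ∫⁻ z, 2 * segmentIntegral g hg
          (fun w ↦ ENNReal.ofReal (Real.sqrt (g.normSq w (g.hessian u w + u w • g.toBilinForm w))))
          0 1 z.1 z.2 ∂((riemannianMeasure h).prod (riemannianMeasure h)) :=
        lintegral_mono fun z ↦ iInf_iSup_ofReal_abs_sin_mul_sub_le g hg hc hu z.1 z.2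
    _ = 2 * ∫⁻ z, segmentIntegral g hg
          (fun w ↦ ENNReal.ofReal (Real.sqrt (g.normSq w (g.hessian u w + u w • g.toBilinForm w))))
          0 1 z.1 z.2 ∂((riemannianMeasure h).prod (riemannianMeasure h)) :=
        lintegral_const_mul 2 hmeas
    _ ≤ _ := mul_le_mul_right hcommon 2

end FactVocabulary

end Literature.Geometry.Riemannian

end
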